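import Summits.QuantumFields.YangMills.Theorems.SwapVirialDeficitBlowUpGnomonicSeamFloorCoords
import HarnessLib

/-!
# «THE END IS BULK»: the anisotropic floor with the seam block absorbed — `u` is stiff with coefficient `sin²2ψ/(1+x₀²) + sin²ψ·x₀²/(1+x₀²)²` at every stratum-A base point
# (free-hands support of ⟨stmt-QuantumFields-24197⟩ `SwapVirialDeficit.SwapGluedStiffness`; region (Ra) of LEAD g98's skeleton ➎, 18:57Z simplification (2):
# `(Ra) := {τ ≤ ψ ≤ π−τ} ∩ {sin²2ψ + x₀² + y₀² ≥ τ²}` needs a blockwise floor whose `u`-coefficient does not vanish at the end `ψ = π/2` when `x₀ ≠ 0`)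

✓`fibre_raySecond_ge_aniso` gives the `u`-block `(2A₀A₁)²·4|u|²/(1+x₀²)` (`= sin²2ψ·…`, vanishing at the end), ✓`fibre_raySecond_ge_seamComm_coords` gives
`x₀²·|2A₁·M(ψ)u + ζ(z)|²/(225L⁶(1+x₀²)²)` with `|M(ψ)u| = |u|` (`A₀² + A₁² = 1`) and `|ζ(z)|² = (1+x₀²)(z₁²+z₂²)`.  Absorbing the `z`-coupling (`|p+ζ|² ≥ ½|p|² − |ζ|²`) into half of the
hard `z`-floor `4|z|²/16200L⁶` with the weights `55/56 ∕ 1/56`: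
* `sq_add_sq_ge_half_sub` (`(p₁+ζ₁)² + (p₂+ζ₂)² ≥ ½(p₁²+p₂²) − (ζ₁²+ζ₂²)`), `rot_normSq` (`|M(ψ)u|² = (A₀²+A₁²)|u|²`);
* ★★★ `fibre_raySecond_ge_endBulk (ha) (ε) (hz) (hε) (x₀ y₀ w)`:
  `A₁²x₀²|u|²/(6300L⁶(1+x₀²)²) + (55/84)·[((2A₀A₁)²·4|u|²/(1+x₀²) + A₁²·4|v|²/(1+y₀²))/16200L⁶ + 2Σ_f|η_f|²/(2304L⁶|Fol L|) + |y₀u − x₀v|²/(450L⁶(1+x₀²)(1+y₀²))] + |z|²/(12150L⁶) ≤ Q(w)`.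
So on `{τ ≤ ψ ≤ π − τ}` (`A₁² = sin²ψ ≥ sin²τ`) the `u`-coefficient is `≥ (sin²2ψ + sin²τ·x₀²/(1+x₀²))/(P(L)(1+x₀²))`, and with the `v`-block and the relative-rotation
term (`min_v [c(y₀u − x₀v)² + b v²] = bc·y₀²u²/(b + c·x₀²)`) also `y₀²` stiffens `u`: the END is bulk off the crossing `Σ = {sin²2ψ + x₀² + y₀² = 0}` (LEAD 18:57Z (2)).

HONEST LABEL: arithmetic on landed floors; the (TS) regions, ⟨24197⟩ ∕ ⟨24194⟩ ∕ ⟨24497⟩ OPEN; own crux ⟨22884⟩ OPEN (blocked-on ⟨19935⟩); the Yang–Mills mass gap is NOT proved;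
no summit is proved by a line.  THEOREMS ONLY (0 `def`, 0 `sorry`), standard axioms.  Width seat ym-line-sfw-p2-w3 g66 (cell ym-idea-1, free hands),
`--supports stmt-QuantumFields-24197`.  References: [cite: Luscher1983, §2]; [folklore].
-/

set_option autoImplicit false

noncomputable section

open MeasureTheory Quaternion
open scoped BigOperators Quaternion
open Literature.MathematicalPhysics.QuantumFieldTheory hiding SU2
open Literature.MathematicalPhysics.QuantumLattice
open Literature.Analysis.Calculus (radialUnit)

namespace Summit.QuantumFields.YangMills.Theorems.SwapVirialDeficit.BlowUpRing

open Summit.QuantumFields.YangMills.Theorems.FemtoTransferGap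
open Summit.QuantumFields.YangMills.Theorems.SwapTwistDeficit.ToronLog (axisPoint)
open Summit.QuantumFields.YangMills.Theorems.SwapVirialDeficit.ZeroModeSigma (norm_axisUnit axial_sq_add_sq)
open Summit.QuantumFields.YangMills.Theorems.SwapVirialDeficit.Gnomonic (normSq3 normSq3_nonneg)

variable {L : ℕ} [NeZero L]

omit [NeZero L] in
/-- `(p₁+ζ₁)² + (p₂+ζ₂)² ≥ ½(p₁²+p₂²) − (ζ₁²+ζ₂²)`. [folklore] -/
theorem sq_add_sq_ge_half_sub (p₁ p₂ ζ₁ ζ₂ : ℝ) : (p₁ ^ 2 + p₂ ^ 2) / 2 - (ζ₁ ^ 2 + ζ₂ ^ 2) ≤ (p₁ + ζ₁) ^ 2 + (p₂ + ζ₂) ^ 2 := by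
  nlinarith [sq_nonneg (p₁ + 2 * ζ₁), sq_nonneg (p₂ + 2 * ζ₂)]

omit [NeZero L] in
/-- `|M(ψ)u|² = (A₀² + A₁²)|u|²` for `M(ψ)u = (−A₁u₀ + A₀u₁, −A₀u₀ − A₁u₁)`. [folklore] -/
theorem rot_normSq (A₀ A₁ u₀ u₁ : ℝ) : (-(A₁ * u₀) + A₀ * u₁) ^ 2 + (-(A₀ * u₀) - A₁ * u₁) ^ 2 = (A₀ ^ 2 + A₁ ^ 2) * (u₀ ^ 2 + u₁ ^ 2) := by ring

set_option maxHeartbeats 800000 in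
/-- ★★★ **«THE END IS BULK»** — the anisotropic floor with the seam block absorbed (principal sector; hub `a ≠ 0`, `ε_z = +`, followers `+`; `A₀ = re a/‖a‖`, `A₁ = ‖im a‖/‖a‖`):
`A₁²x₀²|u|²/(6300L⁶(1+x₀²)²) + (55/84)·[((2A₀A₁)²·4|u|²/(1+x₀²) + A₁²·4|v|²/(1+y₀²))/16200L⁶ + 2Σ_f|η_f|²/(2304L⁶|Fol L|) + |y₀u − x₀v|²/(450L⁶(1+x₀²)(1+y₀²))] + |z|²/(12150L⁶) ≤ (d²/ds²)F̂(η₀ + s·ξ(w))|₀`.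
[cite: Luscher1983, §2] -/
theorem fibre_raySecond_ge_endBulk {a : ℍ} (ha : a ≠ 0) (ε : GnoSign L) (hz : ε.2.1 = true) (hε : ε.2.2 = fun _ => true) (x₀ y₀ : ℝ)
    (w : ((Fin 2 → ℝ) × (Fin 2 → ℝ)) × (Fin 3 → ℝ) × (Fol L → Fin 3 → ℝ)) :
    (‖a‖⁻¹ * ‖a.im‖) ^ 2 * x₀ ^ 2 * (w.1.1 0 ^ 2 + w.1.1 1 ^ 2) / (6300 * (L : ℝ) ^ 6 * (1 + x₀ ^ 2) ^ 2) +
        55 / 84 * (((2 * (‖a‖⁻¹ * a.re) * (‖a‖⁻¹ * ‖a.im‖)) ^ 2 * (4 * (w.1.1 0 ^ 2 + w.1.1 1 ^ 2) / (1 + x₀ ^ 2)) +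
            (‖a‖⁻¹ * ‖a.im‖) ^ 2 * (4 * (w.1.2 0 ^ 2 + w.1.2 1 ^ 2) / (1 + y₀ ^ 2))) / (16200 * (L : ℝ) ^ 6) +
          (∑ f, 2 * normSq3 (w.2.2 f)) / (2304 * (L : ℝ) ^ 6 * (Fintype.card (Fol L) : ℝ)) +
          ((y₀ * w.1.1 0 - x₀ * w.1.2 0) ^ 2 + (y₀ * w.1.1 1 - x₀ * w.1.2 1) ^ 2) / (450 * (L : ℝ) ^ 6 * ((1 + x₀ ^ 2) * (1 + y₀ ^ 2)))) +
        normSq3 w.2.1 / (12150 * (L : ℝ) ^ 6) ≤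
      iteratedDeriv 2 (fun s : ℝ => gnoDeficit (fun _ => false) (fun _ => 1) a ε
        (((((![x₀, 0, 0] : Fin 3 → ℝ), (![y₀, 0, 0] : Fin 3 → ℝ)), ((0 : Fin 3 → ℝ), (0 : Fol L → Fin 3 → ℝ))) : GnoCoord L) +
          s • ((((![0, w.1.1 0, w.1.1 1] : Fin 3 → ℝ), (![0, w.1.2 0, w.1.2 1] : Fin 3 → ℝ)), (w.2.1, w.2.2)) : GnoCoord L))) 0 := by
  have hL : (0 : ℝ) < L := by exact_mod_cast NeZero.pos L
  have h1 := fibre_raySecond_ge_aniso (L := L) ha ε hz hε x₀ y₀ w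
  have h2 := fibre_raySecond_ge_seamComm_coords (L := L) ha ε hz hε x₀ y₀ w
  -- abbreviations
  obtain ⟨Q, hQ⟩ : ∃ Q : ℝ, Q = iteratedDeriv 2 (fun s : ℝ => gnoDeficit (fun _ => false) (fun _ => 1) a ε
        (((((![x₀, 0, 0] : Fin 3 → ℝ), (![y₀, 0, 0] : Fin 3 → ℝ)), ((0 : Fin 3 → ℝ), (0 : Fol L → Fin 3 → ℝ))) : GnoCoord L) +
          s • ((((![0, w.1.1 0, w.1.1 1] : Fin 3 → ℝ), (![0, w.1.2 0, w.1.2 1] : Fin 3 → ℝ)), (w.2.1, w.2.2)) : GnoCoord L))) 0 := ⟨_, rfl⟩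
  rw [← hQ] at h1 h2 ⊢
  set A₀ : ℝ := ‖a‖⁻¹ * a.re with hA₀
  set A₁ : ℝ := ‖a‖⁻¹ * ‖a.im‖ with hA₁
  set U : ℝ := w.1.1 0 ^ 2 + w.1.1 1 ^ 2 with hU
  set Zt : ℝ := w.2.1 1 ^ 2 + w.2.1 2 ^ 2 with hZt
  set JK : ℝ := (2 * A₁ * (-(A₁ * w.1.1 0) + A₀ * w.1.1 1) + (w.2.1 1 - x₀ * w.2.1 2)) ^ 2 +
    (2 * A₁ * (-(A₀ * w.1.1 0) - A₁ * w.1.1 1) + (w.2.1 2 + x₀ * w.2.1 1)) ^ 2 with hJK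
  set HUB : ℝ := ((2 * A₀ * A₁) ^ 2 * (4 * U / (1 + x₀ ^ 2)) + A₁ ^ 2 * (4 * (w.1.2 0 ^ 2 + w.1.2 1 ^ 2) / (1 + y₀ ^ 2))) with hHUB
  set FOL : ℝ := (∑ f, 2 * normSq3 (w.2.2 f)) / (2304 * (L : ℝ) ^ 6 * (Fintype.card (Fol L) : ℝ)) with hFOL
  set ROT : ℝ := ((y₀ * w.1.1 0 - x₀ * w.1.2 0) ^ 2 + (y₀ * w.1.1 1 - x₀ * w.1.2 1) ^ 2) / (450 * (L : ℝ) ^ 6 * ((1 + x₀ ^ 2) * (1 + y₀ ^ 2))) with hROT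
  -- the unit relation and the block sizes
  obtain ⟨hAre, hAimI, hAimJ, hAimK⟩ := axisUnit_components a
  have hunit : A₀ ^ 2 + A₁ ^ 2 = 1 := by
    have h := axial_sq_add_sq (norm_axisUnit ha) hAimJ hAimK
    rw [hAre, hAimI] at h; exact h
  have hx1 : (0 : ℝ) < 1 + x₀ ^ 2 := by positivity
  have hU0 : 0 ≤ U := by positivity
  have hZt0 : 0 ≤ Zt := by positivity
  have hZle : Zt ≤ normSq3 w.2.1 := by
    simp only [hZt, normSq3, Fin.sum_univ_three]; linarith only [sq_nonneg (w.2.1 0)]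
  have hz0 := normSq3_nonneg w.2.1
  -- `JK ≥ 2A₁²U − (1+x₀²)Zt`
  have hJK : 2 * A₁ ^ 2 * U - (1 + x₀ ^ 2) * Zt ≤ JK := by
    have h := sq_add_sq_ge_half_sub (2 * A₁ * (-(A₁ * w.1.1 0) + A₀ * w.1.1 1)) (2 * A₁ * (-(A₀ * w.1.1 0) - A₁ * w.1.1 1))
      (w.2.1 1 - x₀ * w.2.1 2) (w.2.1 2 + x₀ * w.2.1 1)
    have ep : (2 * A₁ * (-(A₁ * w.1.1 0) + A₀ * w.1.1 1)) ^ 2 + (2 * A₁ * (-(A₀ * w.1.1 0) - A₁ * w.1.1 1)) ^ 2 = 4 * A₁ ^ 2 * U := by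
      have := rot_normSq A₀ A₁ (w.1.1 0) (w.1.1 1)
      rw [hunit, one_mul] at this
      rw [hU, ← this]; ring
    have ez : (w.2.1 1 - x₀ * w.2.1 2) ^ 2 + (w.2.1 2 + x₀ * w.2.1 1) ^ 2 = (1 + x₀ ^ 2) * Zt := by rw [hZt]; ring
    rw [ep, ez] at h
    rw [hJK]; linarith only [h]
  -- the seam floor, weakened: `x₀²(2A₁²U − (1+x₀²)Zt)/(225L⁶(1+x₀²)²) ≤ Q`
  have hden : (0 : ℝ) < 225 * (L : ℝ) ^ 6 * (1 + x₀ ^ 2) ^ 2 := by positivity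
  have h2' : x₀ ^ 2 * (2 * A₁ ^ 2 * U - (1 + x₀ ^ 2) * Zt) / (225 * (L : ℝ) ^ 6 * (1 + x₀ ^ 2) ^ 2) ≤ Q :=
    le_trans (div_le_div_of_nonneg_right (mul_le_mul_of_nonneg_left hJK (sq_nonneg x₀)) hden.le) h2
  -- split the weakened seam floor into its `U` part and its `Zt` part
  have hsplit : x₀ ^ 2 * (2 * A₁ ^ 2 * U - (1 + x₀ ^ 2) * Zt) / (225 * (L : ℝ) ^ 6 * (1 + x₀ ^ 2) ^ 2) =
      2 * A₁ ^ 2 * x₀ ^ 2 * U / (225 * (L : ℝ) ^ 6 * (1 + x₀ ^ 2) ^ 2) - x₀ ^ 2 / (1 + x₀ ^ 2) * (Zt / (225 * (L : ℝ) ^ 6)) := by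
    field_simp
  have hxfrac : x₀ ^ 2 / (1 + x₀ ^ 2) ≤ 1 := by rw [div_le_one hx1]; linarith only [sq_nonneg x₀]
  have hZpart : x₀ ^ 2 / (1 + x₀ ^ 2) * (Zt / (225 * (L : ℝ) ^ 6)) ≤ normSq3 w.2.1 / (225 * (L : ℝ) ^ 6) := by
    have hz' : 0 ≤ Zt / (225 * (L : ℝ) ^ 6) := by positivity
    calc x₀ ^ 2 / (1 + x₀ ^ 2) * (Zt / (225 * (L : ℝ) ^ 6)) ≤ 1 * (Zt / (225 * (L : ℝ) ^ 6)) := mul_le_mul_of_nonneg_right hxfrac hz'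
      _ = Zt / (225 * (L : ℝ) ^ 6) := one_mul _
      _ ≤ normSq3 w.2.1 / (225 * (L : ℝ) ^ 6) := div_le_div_of_nonneg_right hZle (by positivity)
  -- rewrite the anisotropic floor with the abbreviations
  have h1' : 2 / 3 * ((HUB + 4 * normSq3 w.2.1) / (16200 * (L : ℝ) ^ 6) + FOL + ROT) ≤ Q := by
    have e : (2 * (‖a‖⁻¹ * a.re) * (‖a‖⁻¹ * ‖a.im‖)) ^ 2 * (4 * (w.1.1 0 ^ 2 + w.1.1 1 ^ 2) / (1 + x₀ ^ 2)) +
        (‖a‖⁻¹ * ‖a.im‖) ^ 2 * (4 * (w.1.2 0 ^ 2 + w.1.2 1 ^ 2) / (1 + y₀ ^ 2)) + 4 * normSq3 w.2.1 = HUB + 4 * normSq3 w.2.1 := by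
      rw [hHUB]
    rw [← e]; exact h1
  -- combine with weights `55/56` and `1/56`
  have hcomb : 55 / 56 * (2 / 3 * ((HUB + 4 * normSq3 w.2.1) / (16200 * (L : ℝ) ^ 6) + FOL + ROT)) +
      1 / 56 * (x₀ ^ 2 * (2 * A₁ ^ 2 * U - (1 + x₀ ^ 2) * Zt) / (225 * (L : ℝ) ^ 6 * (1 + x₀ ^ 2) ^ 2)) ≤ Q := by
    linarith only [h1', h2']
  rw [hsplit] at hcomb
  -- the target's `U`-seam coefficient and `z`-coefficient
  have eU : A₁ ^ 2 * x₀ ^ 2 * U / (6300 * (L : ℝ) ^ 6 * (1 + x₀ ^ 2) ^ 2) = 1 / 56 * (2 * A₁ ^ 2 * x₀ ^ 2 * U / (225 * (L : ℝ) ^ 6 * (1 + x₀ ^ 2) ^ 2)) := by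
    have hd1 : (6300 * (L : ℝ) ^ 6 * (1 + x₀ ^ 2) ^ 2) ≠ 0 := by positivity
    have hd2 : (225 * (L : ℝ) ^ 6 * (1 + x₀ ^ 2) ^ 2) ≠ 0 := by positivity
    rw [mul_div_assoc', div_eq_div_iff hd1 hd2]
    ring
  have eZ : normSq3 w.2.1 / (12150 * (L : ℝ) ^ 6) =
      55 / 56 * (2 / 3 * (4 * normSq3 w.2.1 / (16200 * (L : ℝ) ^ 6))) - 1 / 56 * (normSq3 w.2.1 / (225 * (L : ℝ) ^ 6)) := by
    have hL6 : (L : ℝ) ^ 6 ≠ 0 := by positivity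
    field_simp
    ring
  have eH : 55 / 84 * (HUB / (16200 * (L : ℝ) ^ 6) + FOL + ROT) + 55 / 56 * (2 / 3 * (4 * normSq3 w.2.1 / (16200 * (L : ℝ) ^ 6))) =
      55 / 56 * (2 / 3 * ((HUB + 4 * normSq3 w.2.1) / (16200 * (L : ℝ) ^ 6) + FOL + ROT)) := by
    ring
  -- assemble
  show A₁ ^ 2 * x₀ ^ 2 * U / (6300 * (L : ℝ) ^ 6 * (1 + x₀ ^ 2) ^ 2) + 55 / 84 * (HUB / (16200 * (L : ℝ) ^ 6) + FOL + ROT) +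
      normSq3 w.2.1 / (12150 * (L : ℝ) ^ 6) ≤ Q
  rw [eU, eZ]
  linarith only [hcomb, hZpart, eH]

end Summit.QuantumFields.YangMills.Theorems.SwapVirialDeficit.BlowUpRing

end
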